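import Summits.Ventures.HodgeRepro2.T5SU11ReductionOfOrder

/-!
# The Green's function of the radial operator: variation of parameters for `sinh 2t · u″ + 2 cosh 2t · u′ − μ sinh 2t · u = sinh 2t · f`

Given two solutions `φ, χ` of the radial equation `sinh 2t · u″ + 2 cosh 2t · u′ = μ sinh 2t · u` on `(0, ∞)` with
the normalised Wronskian **`sinh 2t · (φ χ′ − φ′ χ) = −1`** (rows 447–448: `φ` the regular and `χ` the decaying
solution), and a continuous source `f` supported in `[a, b] ⊂ (0, ∞)`, the variation-of-parameters formula

  **`(G f)(t) := −χ(t) ∫_a^t φ(s) f(s) sinh 2s ds − φ(t) ∫_t^b χ(s) f(s) sinh 2s ds`**  (`greenSol`)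

— the Green's function `G(t, s) = −φ(min(t, s)) χ(max(t, s))` (the sign is that of the Wronskian) integrated against
`f(s) sinh 2s ds` — solves the
INHOMOGENEOUS equation **`sinh 2t · u″ + 2 cosh 2t · u′ = μ sinh 2t · u + sinh 2t · f`** on `(0, ∞)`
(`greenSol_ode`; the derivative data `hasDerivAt_greenSol`, `hasDerivAt_greenSol'` by the fundamental theorem of
calculus at both ends, the cross terms cancelling by the Wronskian), and has the boundary behaviour of the basis:
**`G f = −(∫_a^b χ f sinh 2s) · φ` on `(0, a]`** and **`G f = −(∫_a^b φ f sinh 2s) · χ` on `[b, ∞)`**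
(`greenSol_eq_of_le`, `greenSol_eq_of_ge`) — regular at the origin, decaying at infinity. Nothing is claimed
about (N).

Blind lane: Mathlib + the HodgeRepro2 prefix only; no sorry; axioms ⊆ {propext, Classical.choice,
Quot.sound}.
-/

namespace Summit.Ventures.HodgeRepro2.T5SU11RadialGreen

open Filter Topology MeasureTheory intervalIntegral
open Set (Ioi uIcc)
open T5SU11ReductionOfOrder

/-- `B(t) = ∫_a^t φ(s) f(s) sinh 2s ds`. -/
noncomputable def greenB (φ f : ℝ → ℝ) (a t : ℝ) : ℝ := ∫ s in a..t, φ s * f s * Real.sinh (2 * s)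

/-- `A(t) = ∫_t^b χ(s) f(s) sinh 2s ds`. -/
noncomputable def greenA (χ f : ℝ → ℝ) (b t : ℝ) : ℝ := ∫ s in t..b, χ s * f s * Real.sinh (2 * s)

/-- **The Green's solution** `(G f)(t) = −χ(t) B(t) − φ(t) A(t)`. -/
noncomputable def greenSol (φ χ f : ℝ → ℝ) (a b t : ℝ) : ℝ := -(χ t * greenB φ f a t) - φ t * greenA χ f b t

/-- `(G f)′ = −χ′ B − φ′ A` (the cross terms cancel). -/
noncomputable def greenSol' (φ' χ' φ χ f : ℝ → ℝ) (a b t : ℝ) : ℝ :=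
  -(χ' t * greenB φ f a t) - φ' t * greenA χ f b t

/-- `(G f)″ = −χ″ B − φ″ A − (χ′ φ − φ′ χ) f sinh 2t`. -/
noncomputable def greenSol'' (φ'' χ'' φ' χ' φ χ f : ℝ → ℝ) (a b t : ℝ) : ℝ :=
  -(χ'' t * greenB φ f a t) - φ'' t * greenA χ f b t - (χ' t * φ t - φ' t * χ t) * f t * Real.sinh (2 * t)

section

variable {μ a b : ℝ} {φ φ' φ'' χ χ' χ'' f : ℝ → ℝ}
  (hφ : ∀ t, 0 < t → HasDerivAt φ (φ' t) t) (hφ' : ∀ t, 0 < t → HasDerivAt φ' (φ'' t) t)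
  (hφode : ∀ t, 0 < t → Real.sinh (2 * t) * φ'' t + 2 * Real.cosh (2 * t) * φ' t = μ * Real.sinh (2 * t) * φ t)
  (hχ : ∀ t, 0 < t → HasDerivAt χ (χ' t) t) (hχ' : ∀ t, 0 < t → HasDerivAt χ' (χ'' t) t)
  (hχode : ∀ t, 0 < t → Real.sinh (2 * t) * χ'' t + 2 * Real.cosh (2 * t) * χ' t = μ * Real.sinh (2 * t) * χ t)
  (hW : ∀ t, 0 < t → Real.sinh (2 * t) * (φ t * χ' t - φ' t * χ t) = -1)
  (hf : ContinuousOn f (Ioi 0)) (ha : 0 < a) (hab : a ≤ b)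

/-! ### Continuity of the integrands and the fundamental theorem of calculus -/

include hφ hf in
/-- `φ f sinh 2s` is continuous on `(0, ∞)`. -/
theorem continuousOn_greenB_integrand : ContinuousOn (fun s => φ s * f s * Real.sinh (2 * s)) (Ioi 0) := by
  have hφc : ContinuousOn φ (Ioi 0) := fun s hs => (hφ s hs).continuousAt.continuousWithinAt
  exact (hφc.mul hf).mul (Real.continuous_sinh.comp (continuous_const.mul continuous_id)).continuousOn

/-- `[[c, t]] ⊆ (0, ∞)` for `c, t > 0`. -/
theorem uIcc_subset_Ioi {c t : ℝ} (hc : 0 < c) (ht : 0 < t) : uIcc c t ⊆ Ioi 0 := by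
  intro x hx
  rcases Set.mem_uIcc.mp hx with ⟨h1, _⟩ | ⟨h1, _⟩
  · exact lt_of_lt_of_le hc h1
  · exact lt_of_lt_of_le ht h1

include hφ hf ha in
/-- **`B′(t) = φ(t) f(t) sinh 2t`** on `(0, ∞)`. -/
theorem hasDerivAt_greenB {t : ℝ} (ht : 0 < t) :
    HasDerivAt (greenB φ f a) (φ t * f t * Real.sinh (2 * t)) t := by
  have hc := continuousOn_greenB_integrand hφ hf
  show HasDerivAt (fun u => ∫ s in a..u, φ s * f s * Real.sinh (2 * s)) _ t
  exact integral_hasDerivAt_right ((hc.mono (uIcc_subset_Ioi ha ht)).intervalIntegrable)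
    (hc.stronglyMeasurableAtFilter isOpen_Ioi t ht) (hc.continuousAt (isOpen_Ioi.mem_nhds ht))

include hχ hf ha hab in
/-- **`A′(t) = −χ(t) f(t) sinh 2t`** on `(0, ∞)`. -/
theorem hasDerivAt_greenA {t : ℝ} (ht : 0 < t) :
    HasDerivAt (greenA χ f b) (-(χ t * f t * Real.sinh (2 * t))) t := by
  have hc := continuousOn_greenB_integrand hχ hf
  have hb : 0 < b := lt_of_lt_of_le ha hab
  show HasDerivAt (fun u => ∫ s in u..b, χ s * f s * Real.sinh (2 * s)) _ t
  exact integral_hasDerivAt_left ((hc.mono (uIcc_subset_Ioi ht hb)).intervalIntegrable)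
    (hc.stronglyMeasurableAtFilter isOpen_Ioi t ht) (hc.continuousAt (isOpen_Ioi.mem_nhds ht))

/-! ### The derivatives of the Green's solution -/

include hφ hχ hf ha hab in
/-- **`(G f)′ = −χ′ B − φ′ A`**: the cross terms `χ B′ + φ A′ = (χ φ − φ χ) f sinh 2t` cancel. -/
theorem hasDerivAt_greenSol {t : ℝ} (ht : 0 < t) :
    HasDerivAt (greenSol φ χ f a b) (greenSol' φ' χ' φ χ f a b t) t := by
  have h1 := ((hχ t ht).mul (hasDerivAt_greenB hφ hf ha ht)).neg
  have h2 := (hφ t ht).mul (hasDerivAt_greenA hχ hf ha hab ht)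
  have h := h1.sub h2
  show HasDerivAt (fun t => -(χ t * greenB φ f a t) - φ t * greenA χ f b t) _ t
  refine h.congr_deriv ?_
  unfold greenSol'
  ring

include hφ hφ' hχ hχ' hf ha hab in
/-- **`(G f)″ = −χ″ B − φ″ A − (χ′ φ − φ′ χ) f sinh 2t`.** -/
theorem hasDerivAt_greenSol' {t : ℝ} (ht : 0 < t) :
    HasDerivAt (greenSol' φ' χ' φ χ f a b) (greenSol'' φ'' χ'' φ' χ' φ χ f a b t) t := by
  have h1 := ((hχ' t ht).mul (hasDerivAt_greenB hφ hf ha ht)).neg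
  have h2 := (hφ' t ht).mul (hasDerivAt_greenA hχ hf ha hab ht)
  have h := h1.sub h2
  show HasDerivAt (fun t => -(χ' t * greenB φ f a t) - φ' t * greenA χ f b t) _ t
  refine h.congr_deriv ?_
  unfold greenSol''
  ring

/-! ### The inhomogeneous equation -/

include hφode hχode hW in
/-- **THE GREEN'S SOLUTION SOLVES THE INHOMOGENEOUS EQUATION**:
`sinh 2t · (G f)″ + 2 cosh 2t · (G f)′ = μ sinh 2t · (G f) + sinh 2t · f` on `(0, ∞)`. -/
theorem greenSol_ode {t : ℝ} (ht : 0 < t) :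
    Real.sinh (2 * t) * greenSol'' φ'' χ'' φ' χ' φ χ f a b t + 2 * Real.cosh (2 * t) * greenSol' φ' χ' φ χ f a b t
      = μ * Real.sinh (2 * t) * greenSol φ χ f a b t + Real.sinh (2 * t) * f t := by
  unfold greenSol'' greenSol' greenSol
  have e1 := hφode t ht
  have e2 := hχode t ht
  have e3 := hW t ht
  linear_combination -(greenA χ f b t) * e1 - (greenB φ f a t) * e2 - (Real.sinh (2 * t) * f t) * e3

/-! ### The boundary behaviour: a multiple of `φ` near `0`, a multiple of `χ` near `∞` -/

include hχ hf ha hab in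
/-- **On `(0, a]` the Green's solution is `−(∫_a^b χ f sinh 2s) · φ`** when `f` vanishes on `(−∞, a]`. -/
theorem greenSol_eq_of_le (hfa : ∀ s, s ≤ a → f s = 0) {t : ℝ} (ht : 0 < t) (hta : t ≤ a) :
    greenSol φ χ f a b t = -(∫ s in a..b, χ s * f s * Real.sinh (2 * s)) * φ t := by
  have hB : greenB φ f a t = 0 := by
    unfold greenB
    rw [← intervalIntegral.integral_zero]
    refine integral_congr (fun s hs => ?_)
    rcases Set.mem_uIcc.mp hs with ⟨_, h2⟩ | ⟨_, h2⟩
    · rw [hfa s (le_trans h2 hta)]; ring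
    · rw [hfa s h2]; ring
  have hA : greenA χ f b t = ∫ s in a..b, χ s * f s * Real.sinh (2 * s) := by
    unfold greenA
    have hc := continuousOn_greenB_integrand hχ hf
    have hb : 0 < b := lt_of_lt_of_le ha hab
    rw [← integral_add_adjacent_intervals ((hc.mono (uIcc_subset_Ioi ht ha)).intervalIntegrable)
      ((hc.mono (uIcc_subset_Ioi ha hb)).intervalIntegrable)]
    have h0 : ∫ s in t..a, χ s * f s * Real.sinh (2 * s) = 0 := by
      rw [← intervalIntegral.integral_zero]
      refine integral_congr (fun s hs => ?_)
      rcases Set.mem_uIcc.mp hs with ⟨_, h2⟩ | ⟨_, h2⟩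
      · rw [hfa s h2]; ring
      · rw [hfa s (le_trans h2 hta)]; ring
    rw [h0, zero_add]
  unfold greenSol
  rw [hB, hA]
  ring

include hφ hf ha hab in
/-- **On `[b, ∞)` the Green's solution is `−(∫_a^b φ f sinh 2s) · χ`** when `f` vanishes on `[b, ∞)`. -/
theorem greenSol_eq_of_ge (hfb : ∀ s, b ≤ s → f s = 0) {t : ℝ} (htb : b ≤ t) :
    greenSol φ χ f a b t = -(∫ s in a..b, φ s * f s * Real.sinh (2 * s)) * χ t := by
  have hb : 0 < b := lt_of_lt_of_le ha hab
  have ht : 0 < t := lt_of_lt_of_le hb htb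
  have hA : greenA χ f b t = 0 := by
    unfold greenA
    rw [← intervalIntegral.integral_zero]
    refine integral_congr (fun s hs => ?_)
    rcases Set.mem_uIcc.mp hs with ⟨h1, _⟩ | ⟨h1, _⟩
    · rw [hfb s (le_trans htb h1)]; ring
    · rw [hfb s h1]; ring
  have hB : greenB φ f a t = ∫ s in a..b, φ s * f s * Real.sinh (2 * s) := by
    unfold greenB
    have hc := continuousOn_greenB_integrand hφ hf
    rw [← integral_add_adjacent_intervals ((hc.mono (uIcc_subset_Ioi ha hb)).intervalIntegrable)
      ((hc.mono (uIcc_subset_Ioi hb ht)).intervalIntegrable)]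
    have h0 : ∫ s in b..t, φ s * f s * Real.sinh (2 * s) = 0 := by
      rw [← intervalIntegral.integral_zero]
      refine integral_congr (fun s hs => ?_)
      rcases Set.mem_uIcc.mp hs with ⟨h1, _⟩ | ⟨h1, _⟩
      · rw [hfb s h1]; ring
      · rw [hfb s (le_trans htb h1)]; ring
    rw [h0, add_zero]
  unfold greenSol
  rw [hB, hA]
  ring

end

end Summit.Ventures.HodgeRepro2.T5SU11RadialGreen
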